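import Summits.CriticalPhenomena.PercolationContinuityZ3.Theorems.PercNearOneGluingNoHeavyLowerTailThreePointLBSwitching
import Summits.CriticalPhenomena.PercolationContinuityZ3.Theorems.PercNearOneGluingNoHeavyLowerTailCubicThreePointGluingSeriesParallel
import Literature.Probability.Percolation.SahiThreePointSeparation
import Literature.Probability.Percolation.StrongHarrisThreePoint
import Mathlib.Tactic.Ring
import Mathlib.Tactic.Linarith
import HarnessLib

/-!
# `NoHeavyLowerTail` (stmt-CriticalPhenomena-4575) — the INCREASING twin `T_inc` of 3PT-LB: closed form, the twin identity
# `T_inc − F = (q − t)·AG`, and its consequences (sparse regime, AG⁺ / dense sheet, terminal-series-parallel graphs)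

Support file (prover prim-sahi-p2 gen 2, SAHI cell P2; `--supports stmt-CriticalPhenomena-4575`).  No definitions, no named facts, no sorries.

Three terminals `a, b, c` of a finite weighted graph, `μ = prodBernoulli w`; cells `t = μ(abc)`, `u₃ = μ(ab|c)`, `u₂ = μ(ac|b)`, `u₁ = μ(bc|a)`,
`q = μ(a|b|c)` (`q + u₁ + u₂ + u₃ + t = 1`), `AG = q t − e₂(u) ≥ 0` (Gladkov, tree `prodBernoulli_threePoint_strongHarris`), `e₃ = u₁u₂u₃`.
Two instances of Kahn's Conjecture 5 / Sahi's `C₃` live on these five cells: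
* the DECREASING triple `{a↮b},{a↮c},{b↮c}`: `F := E₃ = (1+t)·AG − e₃` — 3PT-LB = SHK3⁺, a THEOREM on every finite weighted graph
  (`ThreePointLB.sahiE3_pairSep_nonneg`, prim-lit-2 / prim-cert-2);
* the INCREASING triple `U_a = {a↔b}∪{a↔c}`, `U_b = {a↔b}∪{b↔c}`, `U_c = {a↔c}∪{b↔c}` ("the terminal is linked to another terminal"):
  `T_inc := E₃(U_a,U_b,U_c)` — OPEN on general graphs (kernel for `≤ 5` vertices: `SahiIncRows.tInc_le_five`); it is the three-terminal member of the
  open increasing E3GRP family `{β, γ, r4, r5, r6}` (prim-ineq-gen-8: each is the same cubic in the cells of its own sunflower; `γ` = `…E3FourPointSplitSunflower`).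
This file records the exact relation between the two and what it buys:
* `prodBernoulli_sahiE3_pairLink_eq` — **`T_inc = (1 + q)·AG − e₃`** (closed form; `F` is the same with `1 + t`: the two are exchanged by the order
  reversal of the partition lattice `M₃`, `q ↔ t`);
* `sahiE3_pairLink_sub_pairSep` — **`T_inc − F = (q − t)·AG`** (twin identity);
* `sahiE3_pairLink_nonneg_of_sparse` — **in the sparse regime `μ(abc) ≤ μ(a|b|c)` the increasing row holds on EVERY finite weighted graph**
  (`T_inc ≥ F ≥ 0` by the twin identity, 3PT-LB and Gladkov); dually `sahiE3_pairSep_ge_pairLink_of_dense` (`F ≥ T_inc` when `t ≥ q`);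
* `sahiE3_pairLink_ge` — `T_inc ≥ −e₃` always; `sahiE3_pairLink_nonneg_of_agPlus` (AG⁺ `e₂ + e₃ ≤ qt` ⇒ `T_inc ≥ 0`), `sahiE3_pairLink_nonneg_of_Ha`
  (the dense sheet `t·AG ≥ e₃` ⇒ `T_inc ≥ 0`): so `T_inc` is open ONLY in the dense regime `t > q`, where it is implied by the dense half of SF3-Hmax;
* `sahiE3_pairLink_eq_Xi_add` — `T_inc = Ξ + q·AG` in the finitary `PrW` cells (`Ξ` = AG⁺ form of `…TerminalClosure`), hence
  **`TSP.sahiE3_pairLink_nonneg` — `T_inc ≥ 0` for every terminal-series-parallel graph** (class `TSP` of `…GluingSeriesParallel`, via `TSP.Xi_nonneg`).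
[cite: LiebSahi2021, eq. (2.1) (the functional E₃)]; [cite: Gladkov2024StrongFKG, Cor. 4.2]; [cite: Kahn2022, Conjecture 5 (arXiv p. 3)]
-/

noncomputable section

namespace Summit.CriticalPhenomena.PercolationContinuityZ3.Theorems

namespace IncTwin

open MeasureTheory Literature.Probability.Percolation Literature.Probability.LatticeModels

variable {V : Type*} [Finite V]

omit [Finite V] in
/-- `{a↔b} ∩ {b↔c} = {a↔b} ∩ {a↔c}` (transitivity). [folklore] -/
private theorem inter_bc_eq (a b c : V) :
    (openConn a b ∩ openConn b c : Set (BondConfig V)) = openConn a b ∩ openConn a c := by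
  ext ω; constructor
  · rintro ⟨hab, hbc⟩; exact ⟨hab, SimpleGraph.Reachable.trans hab hbc⟩
  · rintro ⟨hab, hac⟩; exact ⟨hab, SimpleGraph.Reachable.trans (SimpleGraph.Reachable.symm hab) hac⟩

omit [Finite V] in
/-- `{a↔c} ∩ {b↔c} = {a↔b} ∩ {a↔c}` (transitivity). [folklore] -/
private theorem inter_ac_bc_eq (a b c : V) :
    (openConn a c ∩ openConn b c : Set (BondConfig V)) = openConn a b ∩ openConn a c := by
  ext ω; constructor
  · rintro ⟨hac, hbc⟩; exact ⟨SimpleGraph.Reachable.trans hac (SimpleGraph.Reachable.symm hbc), hac⟩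
  · rintro ⟨hab, hac⟩; exact ⟨hac, SimpleGraph.Reachable.trans (SimpleGraph.Reachable.symm hab) hac⟩

/-- **Closed form of the increasing twin.**  For `μ = prodBernoulli w` and vertices `a, b, c`, with the cells
`abc = {a↔b} ∩ {a↔c}`, `a|b|c = {a↔b}ᶜ ∩ {a↔c}ᶜ ∩ {b↔c}ᶜ`, `ab|c = {a↔b} ∩ {a↔c}ᶜ`, `ac|b = {a↔c} ∩ {a↔b}ᶜ`, `a|bc = {b↔c} ∩ {a↔b}ᶜ`:
`E₃({a↔b}∪{a↔c}, {a↔b}∪{b↔c}, {a↔c}∪{b↔c}) = (1 + μ(a|b|c))·(μ(a|b|c)μ(abc) − [μ(ab|c)μ(ac|b) + μ(ab|c)μ(a|bc) + μ(ac|b)μ(a|bc)]) − μ(ab|c)μ(ac|b)μ(a|bc)`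
— the `q`-weighted twin of `prodBernoulli_sahiE3_pairSep_eq` (`1 + μ(abc)` there).  Bookkeeping identity (pairwise intersections of the
`U`'s are the single connections, the triple intersection is `abc`); not in the sources. [cite: LiebSahi2021, eq. (2.1) (arXiv p. 5)] -/
theorem prodBernoulli_sahiE3_pairLink_eq (w : Sym2 V → unitInterval) (a b c : V) :
    sahiE3 (prodBernoulli w) (openConn a b ∪ openConn a c) (openConn a b ∪ openConn b c) (openConn a c ∪ openConn b c) =
      (1 + (prodBernoulli w).real ((openConn a b)ᶜ ∩ (openConn a c)ᶜ ∩ (openConn b c)ᶜ)) *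
          ((prodBernoulli w).real ((openConn a b)ᶜ ∩ (openConn a c)ᶜ ∩ (openConn b c)ᶜ) *
              (prodBernoulli w).real (openConn a b ∩ openConn a c) -
            ((prodBernoulli w).real (openConn a b ∩ (openConn a c)ᶜ) *
                (prodBernoulli w).real (openConn a c ∩ (openConn a b)ᶜ) +
              (prodBernoulli w).real (openConn a b ∩ (openConn a c)ᶜ) *
                (prodBernoulli w).real (openConn b c ∩ (openConn a b)ᶜ) +
              (prodBernoulli w).real (openConn a c ∩ (openConn a b)ᶜ) *
                (prodBernoulli w).real (openConn b c ∩ (openConn a b)ᶜ))) -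
        (prodBernoulli w).real (openConn a b ∩ (openConn a c)ᶜ) *
          (prodBernoulli w).real (openConn a c ∩ (openConn a b)ᶜ) *
          (prodBernoulli w).real (openConn b c ∩ (openConn a b)ᶜ) := by
  classical
  set μ := prodBernoulli w with hμ
  set Eab : Set (BondConfig V) := openConn a b with hEab
  set Eac : Set (BondConfig V) := openConn a c with hEac
  set Ebc : Set (BondConfig V) := openConn b c with hEbc
  have mEab : MeasurableSet Eab := MeasurableSet.of_discrete
  have mEac : MeasurableSet Eac := MeasurableSet.of_discrete
  have mEbc : MeasurableSet Ebc := MeasurableSet.of_discrete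
  set T : Set (BondConfig V) := Eab ∩ Eac with hT
  have hT₁ : Eab ∩ Ebc = T := inter_bc_eq a b c
  have hT₂ : Eac ∩ Ebc = T := inter_ac_bc_eq a b c
  set x := μ.real Eab with hx
  set y := μ.real Eac with hy
  set z := μ.real Ebc with hz
  set t := μ.real T with ht
  -- the three increasing events and their intersections
  have hA : μ.real (Eab ∪ Eac) = x + y - t := by
    have h := measureReal_union_add_inter (μ := μ) (s := Eab) mEac
    linarith
  have hB : μ.real (Eab ∪ Ebc) = x + z - t := by
    have h := measureReal_union_add_inter (μ := μ) (s := Eab) mEbc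
    rw [hT₁] at h; linarith
  have hC : μ.real (Eac ∪ Ebc) = y + z - t := by
    have h := measureReal_union_add_inter (μ := μ) (s := Eac) mEbc
    rw [hT₂] at h; linarith
  have hTab : T ⊆ Eab := Set.inter_subset_left
  have hTac : T ⊆ Eac := Set.inter_subset_right
  have hTbc : T ⊆ Ebc := by rw [← hT₁]; exact Set.inter_subset_right
  have iAB : (Eab ∪ Eac) ∩ (Eab ∪ Ebc) = Eab := by
    rw [← Set.union_inter_distrib_left, hT₂, Set.union_eq_left.2 hTab]
  have iAC : (Eab ∪ Eac) ∩ (Eac ∪ Ebc) = Eac := by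
    rw [Set.union_comm Eab Eac, ← Set.union_inter_distrib_left, hT₁, Set.union_eq_left.2 hTac]
  have iBC : (Eab ∪ Ebc) ∩ (Eac ∪ Ebc) = Ebc := by
    rw [Set.union_comm Eab Ebc, Set.union_comm Eac Ebc, ← Set.union_inter_distrib_left, Set.union_eq_left.2 hTbc]
  have iABC : (Eab ∪ Eac) ∩ (Eab ∪ Ebc) ∩ (Eac ∪ Ebc) = T := by
    rw [iAB, Set.inter_union_distrib_left, hT₁, ← hT, Set.union_self]
  -- the remaining cells
  have hU3 : μ.real (Eab ∪ Eac ∪ Ebc) = x + y + z - 2 * t := by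
    have h := measureReal_union_add_inter (μ := μ) (s := Eab ∪ Eac) mEbc
    have hI : (Eab ∪ Eac) ∩ Ebc = T := by
      rw [Set.union_inter_distrib_right, hT₁, hT₂, Set.union_self]
    rw [hI] at h
    linarith
  have cQ : μ.real (Eabᶜ ∩ Eacᶜ ∩ Ebcᶜ) = 1 - x - y - z + 2 * t := by
    rw [← Set.compl_union, ← Set.compl_union,
      probReal_compl_eq_one_sub ((mEab.union mEac).union mEbc), hU3]
    ring
  have u₃ : μ.real (Eab ∩ Eacᶜ) = x - t := by
    have h := measureReal_inter_add_sdiff (μ := μ) (s := Eab) mEac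
    rw [Set.sdiff_eq] at h
    linarith
  have u₂ : μ.real (Eac ∩ Eabᶜ) = y - t := by
    have h := measureReal_inter_add_sdiff (μ := μ) (s := Eac) mEab
    rw [Set.sdiff_eq, Set.inter_comm Eac Eab] at h
    linarith
  have u₁ : μ.real (Ebc ∩ Eabᶜ) = z - t := by
    have h := measureReal_inter_add_sdiff (μ := μ) (s := Ebc) mEab
    rw [Set.sdiff_eq, Set.inter_comm Ebc Eab, hT₁] at h
    linarith
  rw [sahiE3_def, iABC, iBC, iAC, iAB, hA, hB, hC, cQ, u₃, u₂, u₁]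
  ring

/-- **Twin identity: `T_inc − F = (q − t)·AG`.**  The increasing and the decreasing pairwise three-point rows of Sahi's `E₃` differ by
`(μ(a|b|c) − μ(abc))` times Gladkov's form `μ(a|b|c)μ(abc) − e₂`. [cite: LiebSahi2021, eq. (2.1) (arXiv p. 5)] -/
theorem sahiE3_pairLink_sub_pairSep (w : Sym2 V → unitInterval) (a b c : V) :
    sahiE3 (prodBernoulli w) (openConn a b ∪ openConn a c) (openConn a b ∪ openConn b c) (openConn a c ∪ openConn b c) -
        sahiE3 (prodBernoulli w) (openConn a b)ᶜ (openConn a c)ᶜ (openConn b c)ᶜ =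
      ((prodBernoulli w).real ((openConn a b)ᶜ ∩ (openConn a c)ᶜ ∩ (openConn b c)ᶜ) -
          (prodBernoulli w).real (openConn a b ∩ openConn a c)) *
        ((prodBernoulli w).real ((openConn a b)ᶜ ∩ (openConn a c)ᶜ ∩ (openConn b c)ᶜ) *
            (prodBernoulli w).real (openConn a b ∩ openConn a c) -
          ((prodBernoulli w).real (openConn a b ∩ (openConn a c)ᶜ) *
              (prodBernoulli w).real (openConn a c ∩ (openConn a b)ᶜ) +
            (prodBernoulli w).real (openConn a b ∩ (openConn a c)ᶜ) *
              (prodBernoulli w).real (openConn b c ∩ (openConn a b)ᶜ) +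
            (prodBernoulli w).real (openConn a c ∩ (openConn a b)ᶜ) *
              (prodBernoulli w).real (openConn b c ∩ (openConn a b)ᶜ))) := by
  rw [prodBernoulli_sahiE3_pairLink_eq, prodBernoulli_sahiE3_pairSep_eq]
  ring

/-- **The increasing row holds in the sparse regime, on every finite weighted graph.**  If `μ(abc) ≤ μ(a|b|c)` then
`0 ≤ E₃({a↔b}∪{a↔c}, {a↔b}∪{b↔c}, {a↔c}∪{b↔c})`: by the twin identity `T_inc = F + (q − t)·AG` with `F ≥ 0` (3PT-LB,
`ThreePointLB.sahiE3_pairSep_nonneg`) and `AG ≥ 0` (Gladkov). [cite: Kahn2022, Conjecture 5 (arXiv p. 3) (this instance, sparse regime)] -/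
theorem sahiE3_pairLink_nonneg_of_sparse (w : Sym2 V → unitInterval) (a b c : V)
    (h : (prodBernoulli w).real (openConn a b ∩ openConn a c) ≤
      (prodBernoulli w).real ((openConn a b)ᶜ ∩ (openConn a c)ᶜ ∩ (openConn b c)ᶜ)) :
    0 ≤ sahiE3 (prodBernoulli w) (openConn a b ∪ openConn a c) (openConn a b ∪ openConn b c) (openConn a c ∪ openConn b c) := by
  have hF := ThreePointLB.sahiE3_pairSep_nonneg w a b c
  have hAG := prodBernoulli_threePoint_strongHarris w a b c
  have hid := sahiE3_pairLink_sub_pairSep w a b c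
  have hqt : 0 ≤ (prodBernoulli w).real ((openConn a b)ᶜ ∩ (openConn a c)ᶜ ∩ (openConn b c)ᶜ) -
      (prodBernoulli w).real (openConn a b ∩ openConn a c) := sub_nonneg.2 h
  have hprod := mul_nonneg hqt (sub_nonneg.2 (by linarith [hAG] :
    (prodBernoulli w).real (openConn a b ∩ (openConn a c)ᶜ) * (prodBernoulli w).real (openConn a c ∩ (openConn a b)ᶜ) +
        (prodBernoulli w).real (openConn a b ∩ (openConn a c)ᶜ) * (prodBernoulli w).real (openConn b c ∩ (openConn a b)ᶜ) +
        (prodBernoulli w).real (openConn a c ∩ (openConn a b)ᶜ) * (prodBernoulli w).real (openConn b c ∩ (openConn a b)ᶜ) ≤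
      (prodBernoulli w).real ((openConn a b)ᶜ ∩ (openConn a c)ᶜ ∩ (openConn b c)ᶜ) *
        (prodBernoulli w).real (openConn a b ∩ openConn a c)))
  nlinarith [hF, hprod, hid]

/-- Dually, **in the dense regime the proved decreasing row dominates the increasing one**: if `μ(a|b|c) ≤ μ(abc)` then
`E₃({a↔b}∪{a↔c}, …) ≤ E₃({a↮b},{a↮c},{b↮c})`. [cite: LiebSahi2021, eq. (2.1) (arXiv p. 5)] -/
theorem sahiE3_pairSep_ge_pairLink_of_dense (w : Sym2 V → unitInterval) (a b c : V)
    (h : (prodBernoulli w).real ((openConn a b)ᶜ ∩ (openConn a c)ᶜ ∩ (openConn b c)ᶜ) ≤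
      (prodBernoulli w).real (openConn a b ∩ openConn a c)) :
    sahiE3 (prodBernoulli w) (openConn a b ∪ openConn a c) (openConn a b ∪ openConn b c) (openConn a c ∪ openConn b c) ≤
      sahiE3 (prodBernoulli w) (openConn a b)ᶜ (openConn a c)ᶜ (openConn b c)ᶜ := by
  have hAG := prodBernoulli_threePoint_strongHarris w a b c
  have hid := sahiE3_pairLink_sub_pairSep w a b c
  have htq : 0 ≤ (prodBernoulli w).real (openConn a b ∩ openConn a c) -
      (prodBernoulli w).real ((openConn a b)ᶜ ∩ (openConn a c)ᶜ ∩ (openConn b c)ᶜ) := sub_nonneg.2 h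
  have hprod := mul_nonneg htq (sub_nonneg.2 hAG)
  nlinarith [hprod, hid]

/-- **`T_inc ≥ −e₃` on every finite weighted graph** (the Gladkov part; compare `prodBernoulli_sahiE3_pairSep_ge`).
[cite: Gladkov2024StrongFKG, Cor. 4.2] -/
theorem sahiE3_pairLink_ge (w : Sym2 V → unitInterval) (a b c : V) :
    -((prodBernoulli w).real (openConn a b ∩ (openConn a c)ᶜ) *
        (prodBernoulli w).real (openConn a c ∩ (openConn a b)ᶜ) *
        (prodBernoulli w).real (openConn b c ∩ (openConn a b)ᶜ)) ≤
      sahiE3 (prodBernoulli w) (openConn a b ∪ openConn a c) (openConn a b ∪ openConn b c) (openConn a c ∪ openConn b c) := by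
  rw [prodBernoulli_sahiE3_pairLink_eq]
  have hAG := prodBernoulli_threePoint_strongHarris w a b c
  have hq : 0 ≤ (prodBernoulli w).real ((openConn a b)ᶜ ∩ (openConn a c)ᶜ ∩ (openConn b c)ᶜ) := measureReal_nonneg
  have h1 : 0 ≤ 1 + (prodBernoulli w).real ((openConn a b)ᶜ ∩ (openConn a c)ᶜ ∩ (openConn b c)ᶜ) := by linarith
  have h2 := mul_nonneg h1 (sub_nonneg.2 hAG)
  linarith

/-- **AG⁺ implies the increasing row.**  If the single cubic inequality `e₂ + e₃ ≤ μ(a|b|c)μ(abc)` (AG⁺, census-validated, open) holds at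
`(w,a,b,c)` then `0 ≤ E₃({a↔b}∪{a↔c}, …)` (indeed `T_inc = AG⁺ + q·AG`). [cite: Gladkov2024StrongFKG, Cor. 4.2] -/
theorem sahiE3_pairLink_nonneg_of_agPlus (w : Sym2 V → unitInterval) (a b c : V)
    (h : (prodBernoulli w).real (openConn a b ∩ (openConn a c)ᶜ) * (prodBernoulli w).real (openConn a c ∩ (openConn a b)ᶜ) +
          (prodBernoulli w).real (openConn a b ∩ (openConn a c)ᶜ) * (prodBernoulli w).real (openConn b c ∩ (openConn a b)ᶜ) +
          (prodBernoulli w).real (openConn a c ∩ (openConn a b)ᶜ) * (prodBernoulli w).real (openConn b c ∩ (openConn a b)ᶜ) +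
        (prodBernoulli w).real (openConn a b ∩ (openConn a c)ᶜ) * (prodBernoulli w).real (openConn a c ∩ (openConn a b)ᶜ) *
          (prodBernoulli w).real (openConn b c ∩ (openConn a b)ᶜ) ≤
      (prodBernoulli w).real ((openConn a b)ᶜ ∩ (openConn a c)ᶜ ∩ (openConn b c)ᶜ) *
        (prodBernoulli w).real (openConn a b ∩ openConn a c)) :
    0 ≤ sahiE3 (prodBernoulli w) (openConn a b ∪ openConn a c) (openConn a b ∪ openConn b c) (openConn a c ∪ openConn b c) := by
  rw [prodBernoulli_sahiE3_pairLink_eq]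
  have hAG := prodBernoulli_threePoint_strongHarris w a b c
  have hq : 0 ≤ (prodBernoulli w).real ((openConn a b)ᶜ ∩ (openConn a c)ᶜ ∩ (openConn b c)ᶜ) := measureReal_nonneg
  have h2 := mul_nonneg hq (sub_nonneg.2 hAG)
  nlinarith [h, h2]

/-- **The dense sheet of SF3-Hmax implies the increasing row.**  If `μ(abc)·(μ(a|b|c)μ(abc) − e₂) ≥ e₃` (`Ha ≥ 0`, i.e.
`μ(abc)² ≥ μ(a↔b)μ(a↔c)μ(b↔c)`; census-validated in the regime `μ(abc) ≥ μ(a|b|c)`, open) then `0 ≤ E₃({a↔b}∪{a↔c}, …)`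
(`T_inc − Ha = (1 + q − t)·AG ≥ 0`).  With `sahiE3_pairLink_nonneg_of_sparse`: the increasing row is open only in the dense regime, where the
dense half of SF3-Hmax implies it. [cite: Gladkov2024StrongFKG, Cor. 4.2] -/
theorem sahiE3_pairLink_nonneg_of_Ha (w : Sym2 V → unitInterval) (a b c : V)
    (h : (prodBernoulli w).real (openConn a b ∩ (openConn a c)ᶜ) * (prodBernoulli w).real (openConn a c ∩ (openConn a b)ᶜ) *
          (prodBernoulli w).real (openConn b c ∩ (openConn a b)ᶜ) ≤
      (prodBernoulli w).real (openConn a b ∩ openConn a c) *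
        ((prodBernoulli w).real ((openConn a b)ᶜ ∩ (openConn a c)ᶜ ∩ (openConn b c)ᶜ) *
            (prodBernoulli w).real (openConn a b ∩ openConn a c) -
          ((prodBernoulli w).real (openConn a b ∩ (openConn a c)ᶜ) * (prodBernoulli w).real (openConn a c ∩ (openConn a b)ᶜ) +
            (prodBernoulli w).real (openConn a b ∩ (openConn a c)ᶜ) * (prodBernoulli w).real (openConn b c ∩ (openConn a b)ᶜ) +
            (prodBernoulli w).real (openConn a c ∩ (openConn a b)ᶜ) * (prodBernoulli w).real (openConn b c ∩ (openConn a b)ᶜ)))) :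
    0 ≤ sahiE3 (prodBernoulli w) (openConn a b ∪ openConn a c) (openConn a b ∪ openConn b c) (openConn a c ∪ openConn b c) := by
  rw [prodBernoulli_sahiE3_pairLink_eq]
  have hAG := prodBernoulli_threePoint_strongHarris w a b c
  have hq : 0 ≤ (prodBernoulli w).real ((openConn a b)ᶜ ∩ (openConn a c)ᶜ ∩ (openConn b c)ᶜ) := measureReal_nonneg
  have ht1 : (prodBernoulli w).real (openConn a b ∩ openConn a c) ≤ 1 := measureReal_le_one
  have hc : 0 ≤ 1 + (prodBernoulli w).real ((openConn a b)ᶜ ∩ (openConn a c)ᶜ ∩ (openConn b c)ᶜ) -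
      (prodBernoulli w).real (openConn a b ∩ openConn a c) := by linarith
  have h2 := mul_nonneg hc (sub_nonneg.2 hAG)
  nlinarith [h, h2]

end IncTwin

/-! ## The finitary (`PrW`) form and the terminal-series-parallel class -/

namespace TerminalGluing

open Finset MeasureTheory Literature.Probability.Percolation Literature.Probability.Percolation.DecisionTree
open Literature.Probability.LatticeModels CubicThreePointStep CubicThreePointJoin CubicThreePointTerminal

variable {V : Type*} [DecidableEq V] [Fintype V]

/-- **`T_inc = Ξ + q·AG` in the finitary cells.**  For `w` supported in `D`: `E₃({a↔b}∪{a↔c}, …) = Ξ(q,u₁,u₂,u₃,t) + q·AG(q,u₁,u₂,u₃,t)` of the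
cells `PrW D p (ev… ∅ a b c)` (`Ξ = σ·AG − e₃` the AG⁺ form, `σ = 1`). [cite: LiebSahi2021, eq. (2.1)] -/
theorem sahiE3_pairLink_eq_Xi_add (w : Sym2 V → unitInterval) (a b c : V) (D : Finset (Sym2 V)) (hw : ∀ e, e ∉ D → w e = 0) :
    sahiE3 (prodBernoulli w) (openConn a b ∪ openConn a c) (openConn a b ∪ openConn b c) (openConn a c ∪ openConn b c) =
      Xi (PrW D (fun e => (w e : ℝ)) (evQ ∅ a b c)) (PrW D (fun e => (w e : ℝ)) (evU₁ ∅ a b c))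
          (PrW D (fun e => (w e : ℝ)) (evU₂ ∅ a b c)) (PrW D (fun e => (w e : ℝ)) (evU₃ ∅ a b c))
          (PrW D (fun e => (w e : ℝ)) (evT ∅ a b c)) +
        PrW D (fun e => (w e : ℝ)) (evQ ∅ a b c) *
          AG (PrW D (fun e => (w e : ℝ)) (evQ ∅ a b c)) (PrW D (fun e => (w e : ℝ)) (evU₁ ∅ a b c))
            (PrW D (fun e => (w e : ℝ)) (evU₂ ∅ a b c)) (PrW D (fun e => (w e : ℝ)) (evU₃ ∅ a b c))
            (PrW D (fun e => (w e : ℝ)) (evT ∅ a b c)) := by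
  have hid := IncTwin.sahiE3_pairLink_sub_pairSep w a b c
  rw [sahiE3_pairSep_eq_F w a b c D hw] at hid
  have hU : (Finset.univ : Finset (Sym2 V)) = D ∪ (Finset.univ \ D) := by
    rw [Finset.union_sdiff_of_subset (Finset.subset_univ D)]
  have hz : ∀ e ∈ Finset.univ \ D, (fun e => ((w e : unitInterval) : ℝ)) e = 0 := fun e he => by
    have : w e = 0 := hw e (Finset.mem_sdiff.1 he).2
    simp only [this]; rfl
  have hd : Disjoint D (Finset.univ \ D) := Finset.disjoint_sdiff
  have eT := real_cellT w a b c
  have eQ := real_cellQ w a b c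
  have eU₁ := real_cellU₁ w a b c
  have eU₂ := real_cellU₂ w a b c
  have eU₃ := real_cellU₃ w a b c
  rw [hU, PrW_union_of_zero D _ _ hz hd] at eT eQ eU₁ eU₂ eU₃
  rw [eT, eQ, eU₁, eU₂, eU₃] at hid
  have key : sahiE3 (prodBernoulli w) (openConn a b ∪ openConn a c) (openConn a b ∪ openConn b c) (openConn a c ∪ openConn b c) =
      CubicThreePointStep.F (PrW D (fun e => (w e : ℝ)) (evQ ∅ a b c)) (PrW D (fun e => (w e : ℝ)) (evU₁ ∅ a b c))
          (PrW D (fun e => (w e : ℝ)) (evU₂ ∅ a b c)) (PrW D (fun e => (w e : ℝ)) (evU₃ ∅ a b c))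
          (PrW D (fun e => (w e : ℝ)) (evT ∅ a b c)) +
        (PrW D (fun e => (w e : ℝ)) (evQ ∅ a b c) - PrW D (fun e => (w e : ℝ)) (evT ∅ a b c)) *
          AG (PrW D (fun e => (w e : ℝ)) (evQ ∅ a b c)) (PrW D (fun e => (w e : ℝ)) (evU₁ ∅ a b c))
            (PrW D (fun e => (w e : ℝ)) (evU₂ ∅ a b c)) (PrW D (fun e => (w e : ℝ)) (evU₃ ∅ a b c))
            (PrW D (fun e => (w e : ℝ)) (evT ∅ a b c)) := by
    simp only [AG]; linarith
  rw [key]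
  simp only [CubicThreePointStep.F, Xi, AG]
  ring

/-- **`T_inc ≥ 0` for every terminal-series-parallel graph.**  For `prodBernoulli w` with `w` supported on a finite edge set `D` with
`TSP D ∅ a b c` (chords, terminal joins, pendant two-terminal networks, terminal swaps — all graphs on `≤ 4` vertices, `K₅` minus the hub edge,
blob triangles / blob stars, …): `0 ≤ E₃({a↔b}∪{a↔c}, {a↔b}∪{b↔c}, {a↔c}∪{b↔c})`, via `T_inc = Ξ + q·AG` and `TSP.Xi_nonneg` (`Hmax3 ⇒ H_{q+t} ⇒ AG⁺`
on the class). [cite: Kahn2022, Conjecture 5 (arXiv p. 3) (this instance, for this class)] -/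
theorem TSP.sahiE3_pairLink_nonneg (w : Sym2 V → unitInterval) {D : Finset (Sym2 V)} {a b c : V}
    (hw : ∀ e, e ∉ D → w e = 0) (h : TSP D ∅ a b c) :
    0 ≤ sahiE3 (prodBernoulli w) (openConn a b ∪ openConn a c) (openConn a b ∪ openConn b c) (openConn a c ∪ openConn b c) := by
  have hp0 : ∀ e, 0 ≤ (fun e => ((w e : unitInterval) : ℝ)) e := fun e => unitInterval.nonneg (w e)
  have hp1 : ∀ e, (fun e => ((w e : unitInterval) : ℝ)) e ≤ 1 := fun e => unitInterval.le_one (w e)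
  rw [sahiE3_pairLink_eq_Xi_add w a b c D hw]
  have hXi := h.Xi_nonneg hp0 hp1
  have hAG := (h.sharp hp0 hp1).1
  have hq : 0 ≤ PrW D (fun e => ((w e : unitInterval) : ℝ)) (evQ ∅ a b c) := PrW_nonneg D hp0 hp1 _
  exact add_nonneg hXi (mul_nonneg hq hAG)

end TerminalGluing

end Summit.CriticalPhenomena.PercolationContinuityZ3.Theorems
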